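import Literature.Analysis.FluidPDE.TaoCascadeRescaled
import Literature.Analysis.ODE.LinearComparison
import Literature.Analysis.ODE.MaximalTime
import Mathlib.Analysis.SpecialFunctions.Pow.Real
import Mathlib.Analysis.SpecialFunctions.Sqrt
import HarnessLib

/-!
# Tao's cascade ODE, proof of Prop. 6.5 — I: the cumulative energy bound (Lemma 6.7)

T. Tao, *Finite time blowup for an averaged three-dimensional Navier–Stokes equation*,
J. Amer. Math. Soc. 29 (2016), 601–674 (arXiv:1402.0290v3), §6.4, Lemma 6.7, p. 34. Everything
here is **proved**, under the hypotheses `RescaledHypotheses γ …` of Prop. 6.5 (the landed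
`TaoCascadeRescaled.lean`, any `X₃`-coefficient `γ`) and explicit parameter inequalities standing in
for "`K` sufficiently large":

* basic API of `RescaledHypotheses` (monotone rescaled times, mode ≤ energy, continuity,
  one-sided derivatives);
* **Lemma 6.7 (cumulative energy bound)** in explicit form: on `[τ_{k-1}, τ_k]` the energies
  `Ẽ_{-1}, Ẽ_0, Ẽ_1` are `≤ 2^{11} (1+ε₀)^{(499/50) k}` (`energy_past_le`), whence
  `∫_{τ_{n₀-N}}^0 Ẽ_m ≤ cumEnergyConst ε₀ C₃` for `m ∈ {-1, 0, 1}` (`integral_energy_past_le`),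
  and the refined `∫_{τ_{n₀-N}}^{τ_k} Ẽ_1 ≤ K^{-30} C₃ geomConst ε₀ (1+ε₀)^{(747/100) k}`;

Lemma 6.8 and the bootstrap time `T₁` follow in `TaoCascadeRescaledBootstrap.lean`.

Display labels (6.N) are the ordinal convention of the `TaoCascade*` files (offset `+2` = arXiv
v3 numbering); authoritative locators are lemma numbers.

## References

* T. Tao, J. Amer. Math. Soc. 29 (2016), 601–674, §6.4 Lemma 6.7, §6.5 Lemma 6.8 and the
  definition of `T₁` (p. 35). [`Tao2016AveragedNS`]
-/

noncomputable section

open Set MeasureTheory intervalIntegral Filter Topology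
open Literature.Analysis.ODE

namespace Literature.Analysis.FluidPDE

namespace TaoCascade

section Basic

variable {γ ε₀ K ε C₁ C₂ C₃ : ℝ} {n₀ N : ℤ} {τ : ℤ → ℝ} {Xr : Fin 4 → ℤ → ℝ → ℝ} {Er : ℤ → ℝ → ℝ}

/-! ## Basic API of the hypotheses of Prop. 6.5 -/

/-- The initial rescaled time is `≤ 0 = τ_0` (from (vii)). [cite: Tao2016AveragedNS, §6.4 Prop. 6.5 (vii)] -/
theorem RescaledHypotheses.tau_init_le (h : RescaledHypotheses γ ε₀ K ε C₁ C₂ C₃ n₀ N τ Xr Er)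
    (hN : n₀ ≤ N) : τ (n₀ - N) ≤ 0 :=
  h.tau_le _ le_rfl (by omega)

/-- (vii), lower bound, with the exponent written `-(251/100) k` for `k ≤ 0`
(`(5/2 + 1/100)|k| = -(251/100) k`). [cite: Tao2016AveragedNS, §6.4 Prop. 6.5 (vii)] -/
theorem RescaledHypotheses.tau_ge' (h : RescaledHypotheses γ ε₀ K ε C₁ C₂ C₃ n₀ N τ Xr Er) (k : ℤ)
    (hk1 : n₀ - N ≤ k) (hk2 : k ≤ 0) : -(C₃ * (1 + ε₀) ^ (-(251 : ℝ) / 100 * k)) ≤ τ k := by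
  have := h.tau_ge k hk1 hk2
  have hk : |(k : ℝ)| = -(k : ℝ) := abs_of_nonpos (by exact_mod_cast hk2)
  rw [hk] at this
  convert this using 4
  ring

/-- (ix), first display, with `|k-1|/50` written `(1-k)/50` (`k ≤ 0`) and the time quantified
before `m`. [cite: Tao2016AveragedNS, §6.4 Prop. 6.5 (ix)] -/
theorem RescaledHypotheses.en_before' (h : RescaledHypotheses γ ε₀ K ε C₁ C₂ C₃ n₀ N τ Xr Er)
    (k : ℤ) (hk : n₀ - N < k) (hk0 : k ≤ 0) (t : ℝ) (ht : t ∈ Icc (τ (k - 1)) (τ k)) (m : ℕ)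
    (hm : 2 ≤ m) : Er (k - m) t ≤ (K ^ 10)⁻¹ * (1 + ε₀) ^ ((m : ℝ) / 10 + (1 - k) / 50) := by
  have := h.en_before k hk hk0 m hm t ht
  have hkR : (k : ℝ) ≤ 0 := by exact_mod_cast hk0
  have hk' : |(k : ℝ) - 1| = 1 - (k : ℝ) := by
    rw [abs_of_nonpos (by linarith)]; ring
  rwa [hk'] at this

/-- (ix), second display, with `|k-1|/50` written `(1-k)/50`. [cite: Tao2016AveragedNS, §6.4 Prop. 6.5 (ix)] -/
theorem RescaledHypotheses.en_during' (h : RescaledHypotheses γ ε₀ K ε C₁ C₂ C₃ n₀ N τ Xr Er)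
    (k : ℤ) (hk : n₀ - N < k) (hk0 : k ≤ 0) (t : ℝ) (ht : t ∈ Icc (τ (k - 1)) (τ k)) :
    Er (k - 1) t + Er k t ≤ (1 + ε₀) ^ ((1 - (k : ℝ)) / 50) := by
  have := h.en_during k hk hk0 t ht
  have hkR : (k : ℝ) ≤ 0 := by exact_mod_cast hk0
  have hk' : |(k : ℝ) - 1| = 1 - (k : ℝ) := by
    rw [abs_of_nonpos (by linarith)]; ring
  rwa [hk'] at this

/-- (ix), third display, with `|k-1|/50` written `(1-k)/50` and the time quantified before `m`.
[cite: Tao2016AveragedNS, §6.4 Prop. 6.5 (ix)] -/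
theorem RescaledHypotheses.en_after' (h : RescaledHypotheses γ ε₀ K ε C₁ C₂ C₃ n₀ N τ Xr Er)
    (k : ℤ) (hk : n₀ - N < k) (hk0 : k ≤ 0) (t : ℝ) (ht : t ∈ Icc (τ (k - 1)) (τ k)) (m : ℕ)
    (hm : 1 ≤ m) : Er (k + m) t ≤ (K ^ 30)⁻¹ * (1 + ε₀) ^ (-(10 : ℝ) * m + (1 - k) / 50) := by
  have := h.en_after k hk hk0 m hm t ht
  have hkR : (k : ℝ) ≤ 0 := by exact_mod_cast hk0
  have hk' : |(k : ℝ) - 1| = 1 - (k : ℝ) := by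
    rw [abs_of_nonpos (by linarith)]; ring
  rwa [hk'] at this

/-- The rescaled times are monotone on `[n₀-N, 0]`. [cite: Tao2016AveragedNS, §6.4 Prop. 6.5] -/
theorem RescaledHypotheses.tau_mono (h : RescaledHypotheses γ ε₀ K ε C₁ C₂ C₃ n₀ N τ Xr Er) {j k : ℤ}
    (hj : n₀ - N ≤ j) (hjk : j ≤ k) (hk : k ≤ 0) : τ j ≤ τ k := by
  induction k, hjk using Int.leInduction with
  | base => exact le_rfl
  | succ k hjk' ih =>
    have hlt := h.tau_lt (k + 1) (by omega) hk
    simp only [add_sub_cancel_right] at hlt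
    exact (ih (by omega)).trans hlt.le

/-- `τ_{n₀-N} ≤ τ_k` for `n₀ - N ≤ k ≤ 0`. [cite: Tao2016AveragedNS, §6.4 Prop. 6.5] -/
theorem RescaledHypotheses.tau_init_le_tau (h : RescaledHypotheses γ ε₀ K ε C₁ C₂ C₃ n₀ N τ Xr Er)
    {k : ℤ} (hk1 : n₀ - N ≤ k) (hk2 : k ≤ 0) : τ (n₀ - N) ≤ τ k :=
  h.tau_mono le_rfl hk1 hk2

/-- Each mode is controlled by the energy: `Xr_i² ≤ 2 Ẽ_k` ((6.49), lower bound).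
[cite: Tao2016AveragedNS, §6.4 Prop. 6.5 (iv)] -/
theorem RescaledHypotheses.sq_le_two_mul_energy
    (h : RescaledHypotheses γ ε₀ K ε C₁ C₂ C₃ n₀ N τ Xr Er) (i : Fin 4) (k : ℤ) {t : ℝ}
    (ht : τ (n₀ - N) ≤ t) : Xr i k t ^ 2 ≤ 2 * Er k t := by
  have hd := h.defect_lower k t ht
  have hsum : Xr i k t ^ 2 ≤ ∑ j, Xr j k t ^ 2 := by
    rw [Fin.sum_univ_four]
    fin_cases i <;> simp <;> nlinarith [sq_nonneg (Xr 0 k t), sq_nonneg (Xr 1 k t),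
      sq_nonneg (Xr 2 k t), sq_nonneg (Xr 3 k t)]
  linarith

/-- `|Xr_i| ≤ (2 Ẽ_k)^{1/2}`. [cite: Tao2016AveragedNS, §6.4 Prop. 6.5 (iv)] -/
theorem RescaledHypotheses.abs_le_sqrt_energy
    (h : RescaledHypotheses γ ε₀ K ε C₁ C₂ C₃ n₀ N τ Xr Er) (i : Fin 4) (k : ℤ) {t : ℝ}
    (ht : τ (n₀ - N) ≤ t) : |Xr i k t| ≤ Real.sqrt (2 * Er k t) := by
  rw [← Real.sqrt_sq_eq_abs]
  exact Real.sqrt_le_sqrt (h.sq_le_two_mul_energy i k ht)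

/-- `|Xr_i| ≤ B` whenever `2 Ẽ_k ≤ B²` and `B ≥ 0`. [cite: Tao2016AveragedNS, §6.4 Prop. 6.5 (iv)] -/
theorem RescaledHypotheses.abs_le_of_energy_le
    (h : RescaledHypotheses γ ε₀ K ε C₁ C₂ C₃ n₀ N τ Xr Er) (i : Fin 4) (k : ℤ) {t B : ℝ}
    (ht : τ (n₀ - N) ≤ t) (hB : 0 ≤ B) (hE : 2 * Er k t ≤ B ^ 2) : |Xr i k t| ≤ B :=
  abs_le.mpr (abs_le_of_sq_le_sq' ((h.sq_le_two_mul_energy i k ht).trans hE) hB)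

/-- Continuity of the modes on compact intervals past `τ_{n₀-N}`.
[cite: Tao2016AveragedNS, §6.4 Prop. 6.5] -/
theorem RescaledHypotheses.continuousOn_X
    (h : RescaledHypotheses γ ε₀ K ε C₁ C₂ C₃ n₀ N τ Xr Er) (i : Fin 4) (k : ℤ) {a b : ℝ}
    (ha : τ (n₀ - N) ≤ a) : ContinuousOn (Xr i k) (Icc a b) :=
  continuousOn_Icc_of_contDiffOn (h.contDiffOn_Y i k) ha

/-- Continuity of the energies on compact intervals past `τ_{n₀-N}`.
[cite: Tao2016AveragedNS, §6.4 Prop. 6.5] -/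
theorem RescaledHypotheses.continuousOn_E
    (h : RescaledHypotheses γ ε₀ K ε C₁ C₂ C₃ n₀ N τ Xr Er) (k : ℤ) {a b : ℝ}
    (ha : τ (n₀ - N) ≤ a) : ContinuousOn (Er k) (Icc a b) :=
  continuousOn_Icc_of_contDiffOn (h.contDiffOn_F k) ha

/-- One-sided derivatives of the modes in the form consumed by the comparison lemmas.
[cite: Tao2016AveragedNS, §6.4 Prop. 6.5] -/
theorem RescaledHypotheses.hasDeriv_X
    (h : RescaledHypotheses γ ε₀ K ε C₁ C₂ C₃ n₀ N τ Xr Er) (i : Fin 4) (k : ℤ) {t : ℝ}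
    (ht : τ (n₀ - N) ≤ t) :
    HasDerivWithinAt (Xr i k) (derivWithin (Xr i k) (Ici (τ (n₀ - N))) t) (Ici t) t :=
  hasDerivWithinAt_Ici_of_contDiffOn (h.contDiffOn_Y i k) ht

/-- One-sided derivatives of the energies. [cite: Tao2016AveragedNS, §6.4 Prop. 6.5] -/
theorem RescaledHypotheses.hasDeriv_E
    (h : RescaledHypotheses γ ε₀ K ε C₁ C₂ C₃ n₀ N τ Xr Er) (k : ℤ) {t : ℝ}
    (ht : τ (n₀ - N) ≤ t) :
    HasDerivWithinAt (Er k) (derivWithin (Er k) (Ici (τ (n₀ - N))) t) (Ici t) t :=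
  hasDerivWithinAt_Ici_of_contDiffOn (h.contDiffOn_F k) ht

/-! ## Lemma 6.7: energies in the past and the cumulative energy bound -/

/-- **Scale-by-scale bound of the past energies** (the display in the proof of Lemma 6.7:
"`Ẽ_m(t) ≲ (1+ε₀)^{10k+|k|/50}` whenever `τ_{k-1} ≤ t ≤ τ_k`"), made explicit for
`m ∈ {-1, 0, 1}` and `K ≥ 1`: `Ẽ_m(t) ≤ 2^{11} (1+ε₀)^{(499/50) k}`.
[cite: Tao2016AveragedNS, §6.4 Lemma 6.7] -/
theorem RescaledHypotheses.energy_past_le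
    (h : RescaledHypotheses γ ε₀ K ε C₁ C₂ C₃ n₀ N τ Xr Er) (hε₀ : 0 < ε₀) (hε₀1 : ε₀ < 1)
    (hK : 1 ≤ K) {m : ℤ} (hm : m = -1 ∨ m = 0 ∨ m = 1) {k : ℤ} (hk : n₀ - N < k) (hk0 : k ≤ 0)
    {t : ℝ} (ht : t ∈ Icc (τ (k - 1)) (τ k)) :
    Er m t ≤ 2 ^ 11 * (1 + ε₀) ^ ((499 : ℝ) / 50 * k) := by
  have h0 : (0 : ℝ) < 1 + ε₀ := by linarith
  have h1 : (1 : ℝ) ≤ 1 + ε₀ := by linarith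
  have hq2 : (1 + ε₀ : ℝ) ≤ 2 := by linarith
  have hτt : τ (n₀ - N) ≤ t := (h.tau_init_le_tau (by omega) (by omega)).trans ht.1
  have hK10 : (K ^ 10)⁻¹ ≤ 1 := inv_le_one_of_one_le₀ (one_le_pow₀ hK)
  have hK30 : (K ^ 30)⁻¹ ≤ 1 := inv_le_one_of_one_le₀ (one_le_pow₀ hK)
  have hP : 0 < (1 + ε₀) ^ ((499 : ℝ) / 50 * k) := Real.rpow_pos_of_pos h0 _
  -- small rpow facts
  have hsmall : ∀ x : ℝ, 0 ≤ x → x ≤ 11 → (1 + ε₀) ^ x ≤ 2 ^ 11 := by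
    intro x hx hx11
    calc (1 + ε₀) ^ x ≤ (2 : ℝ) ^ x := Real.rpow_le_rpow h0.le hq2 hx
      _ ≤ (2 : ℝ) ^ (11 : ℝ) := Real.rpow_le_rpow_of_exponent_le (by norm_num) hx11
      _ = 2 ^ 11 := by norm_num
  rcases hm with rfl | rfl | rfl
  · -- m = -1
    rcases lt_trichotomy k (-1) with hk' | rfl | hk'
    · -- k ≤ -2: after-bound with m' = -1-k ≥ 1
      obtain ⟨m', hm'⟩ : ∃ m' : ℕ, (m' : ℤ) = -1 - k := ⟨(-1 - k).toNat, by omega⟩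
      have hb := h.en_after' k hk hk0 t ht m' (by omega)
      rw [show k + (m' : ℤ) = -1 by omega] at hb
      have hexp : -(10 : ℝ) * m' + (1 - k) / 50 = (501 : ℝ) / 50 + (499 : ℝ) / 50 * k := by
        have : (m' : ℝ) = -1 - (k : ℝ) := by exact_mod_cast hm'
        rw [this]; ring
      rw [hexp, Real.rpow_add h0] at hb
      calc Er (-1) t ≤ (K ^ 30)⁻¹ * ((1 + ε₀) ^ ((501 : ℝ) / 50) * (1 + ε₀) ^ ((499 : ℝ) / 50 * k)) := hb
        _ ≤ 1 * (2 ^ 11 * (1 + ε₀) ^ ((499 : ℝ) / 50 * k)) := by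
            apply mul_le_mul hK30 _ (by positivity) zero_le_one
            exact mul_le_mul_of_nonneg_right (hsmall _ (by norm_num) (by norm_num)) hP.le
        _ = _ := by ring
    · -- k = -1: during-bound at k = -1
      have hb := h.en_during' (-1) hk hk0 t ht
      have hnn : 0 ≤ Er (-1 - 1) t := h.nonneg_F _ _ hτt
      have hE : Er (-1) t ≤ (1 + ε₀) ^ ((1 - ((-1 : ℤ) : ℝ)) / 50) :=
        (le_add_of_nonneg_left hnn).trans hb
      have hinv : (1 + ε₀) ^ ((499 : ℝ) / 50 * ((-1 : ℤ) : ℝ)) =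
          ((1 + ε₀) ^ ((499 : ℝ) / 50))⁻¹ := by
        rw [← Real.rpow_neg h0.le]; congr 1; push_cast; ring
      rw [hinv, ← div_eq_mul_inv, le_div_iff₀ (Real.rpow_pos_of_pos h0 _)]
      calc Er (-1) t * (1 + ε₀) ^ ((499 : ℝ) / 50)
          ≤ (1 + ε₀) ^ ((1 - ((-1 : ℤ) : ℝ)) / 50) * (1 + ε₀) ^ ((499 : ℝ) / 50) :=
            mul_le_mul_of_nonneg_right hE (Real.rpow_pos_of_pos h0 _).le
        _ = (1 + ε₀) ^ ((1 - ((-1 : ℤ) : ℝ)) / 50 + (499 : ℝ) / 50) := (Real.rpow_add h0 _ _).symm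
        _ ≤ 2 ^ 11 := hsmall _ (by norm_num) (by norm_num)
    · -- k = 0
      obtain rfl : k = 0 := by omega
      have hb := h.en_during' 0 hk hk0 t ht
      have hnn : 0 ≤ Er 0 t := h.nonneg_F _ _ hτt
      have h01 : Er (-1) t = Er (0 - 1) t := by norm_num
      calc Er (-1) t = Er (0 - 1) t := h01
        _ ≤ Er (0 - 1) t + Er 0 t := le_add_of_nonneg_right hnn
        _ ≤ (1 + ε₀) ^ ((1 - ((0 : ℤ) : ℝ)) / 50) := hb
        _ ≤ 2 ^ 11 := hsmall _ (by norm_num) (by norm_num)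
        _ = 2 ^ 11 * (1 + ε₀) ^ ((499 : ℝ) / 50 * ((0 : ℤ) : ℝ)) := by simp
  · -- m = 0
    rcases lt_or_eq_of_le hk0 with hk' | rfl
    · obtain ⟨m', hm'⟩ : ∃ m' : ℕ, (m' : ℤ) = -k := ⟨(-k).toNat, by omega⟩
      have hb := h.en_after' k hk hk0 t ht m' (by omega)
      rw [show k + (m' : ℤ) = 0 by omega] at hb
      have hexp : -(10 : ℝ) * m' + (1 - k) / 50 = (1 : ℝ) / 50 + (499 : ℝ) / 50 * k := by
        have : (m' : ℝ) = -(k : ℝ) := by exact_mod_cast hm'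
        rw [this]; ring
      rw [hexp, Real.rpow_add h0] at hb
      calc Er 0 t ≤ (K ^ 30)⁻¹ * ((1 + ε₀) ^ ((1 : ℝ) / 50) * (1 + ε₀) ^ ((499 : ℝ) / 50 * k)) := hb
        _ ≤ 1 * (2 ^ 11 * (1 + ε₀) ^ ((499 : ℝ) / 50 * k)) := by
            apply mul_le_mul hK30 _ (by positivity) zero_le_one
            exact mul_le_mul_of_nonneg_right (hsmall _ (by norm_num) (by norm_num)) hP.le
        _ = _ := by ring
    · have hb := h.en_during' 0 hk hk0 t ht
      have hnn : 0 ≤ Er (0 - 1) t := h.nonneg_F _ _ hτt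
      calc Er 0 t ≤ Er (0 - 1) t + Er 0 t := le_add_of_nonneg_left hnn
        _ ≤ (1 + ε₀) ^ ((1 - ((0 : ℤ) : ℝ)) / 50) := hb
        _ ≤ 2 ^ 11 := hsmall _ (by norm_num) (by norm_num)
        _ = 2 ^ 11 * (1 + ε₀) ^ ((499 : ℝ) / 50 * ((0 : ℤ) : ℝ)) := by simp
  · -- m = 1: after-bound with m' = 1 - k ≥ 1
    obtain ⟨m', hm'⟩ : ∃ m' : ℕ, (m' : ℤ) = 1 - k := ⟨(1 - k).toNat, by omega⟩
    have hb := h.en_after' k hk hk0 t ht m' (by omega)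
    rw [show k + (m' : ℤ) = 1 by omega] at hb
    have hexp : -(10 : ℝ) * m' + (1 - k) / 50 = -(499 : ℝ) / 50 + (499 : ℝ) / 50 * k := by
      have : (m' : ℝ) = 1 - (k : ℝ) := by exact_mod_cast hm'
      rw [this]; ring
    rw [hexp, Real.rpow_add h0] at hb
    have hneg : (1 + ε₀) ^ (-(499 : ℝ) / 50) ≤ 1 :=
      Real.rpow_le_one_of_one_le_of_nonpos h1 (by norm_num)
    calc Er 1 t ≤ (K ^ 30)⁻¹ * ((1 + ε₀) ^ (-(499 : ℝ) / 50) * (1 + ε₀) ^ ((499 : ℝ) / 50 * k)) := hb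
      _ ≤ 1 * (2 ^ 11 * (1 + ε₀) ^ ((499 : ℝ) / 50 * k)) := by
          apply mul_le_mul hK30 _ (by positivity) zero_le_one
          exact mul_le_mul_of_nonneg_right (hneg.trans (by norm_num)) hP.le
      _ = _ := by ring

/-- The refined past bound for `Ẽ_1` keeping the factor `K^{-30}`:
`Ẽ_1(t) ≤ K^{-30} (1+ε₀)^{(499/50) k}` on `[τ_{k-1}, τ_k]` (proof of Prop. 6.13, display (6.95):
"`Ẽ_1(t) ≲ K^{-30} (1+ε₀)^{10k}`"). [cite: Tao2016AveragedNS, §6.6 Prop. 6.13] -/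
theorem RescaledHypotheses.energy_one_past_le
    (h : RescaledHypotheses γ ε₀ K ε C₁ C₂ C₃ n₀ N τ Xr Er) (hε₀ : 0 < ε₀)
    {k : ℤ} (hk : n₀ - N < k) (hk0 : k ≤ 0) {t : ℝ} (ht : t ∈ Icc (τ (k - 1)) (τ k)) :
    Er 1 t ≤ (K ^ 30)⁻¹ * (1 + ε₀) ^ ((499 : ℝ) / 50 * k) := by
  have h0 : (0 : ℝ) < 1 + ε₀ := by linarith
  have h1 : (1 : ℝ) ≤ 1 + ε₀ := by linarith
  obtain ⟨m', hm'⟩ : ∃ m' : ℕ, (m' : ℤ) = 1 - k := ⟨(1 - k).toNat, by omega⟩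
  have hb := h.en_after' k hk hk0 t ht m' (by omega)
  rw [show k + (m' : ℤ) = 1 by omega] at hb
  have hexp : -(10 : ℝ) * m' + (1 - k) / 50 = -(499 : ℝ) / 50 + (499 : ℝ) / 50 * k := by
    have : (m' : ℝ) = 1 - (k : ℝ) := by exact_mod_cast hm'
    rw [this]; ring
  rw [hexp, Real.rpow_add h0] at hb
  have hneg : (1 + ε₀) ^ (-(499 : ℝ) / 50) ≤ 1 :=
    Real.rpow_le_one_of_one_le_of_nonpos h1 (by norm_num)
  have hP : 0 < (1 + ε₀) ^ ((499 : ℝ) / 50 * k) := Real.rpow_pos_of_pos h0 _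
  calc Er 1 t ≤ (K ^ 30)⁻¹ * ((1 + ε₀) ^ (-(499 : ℝ) / 50) * (1 + ε₀) ^ ((499 : ℝ) / 50 * k)) := hb
    _ ≤ (K ^ 30)⁻¹ * (1 * (1 + ε₀) ^ ((499 : ℝ) / 50 * k)) := by
        apply mul_le_mul_of_nonneg_left _ (by positivity)
        exact mul_le_mul_of_nonneg_right hneg hP.le
    _ = _ := by ring

/-- The geometric-series factor `(1+ε₀)^{251/100} / (1 - (1+ε₀)^{-s})` of the cumulative bounds,
for a decay rate `s > 0`. [cite: Tao2016AveragedNS, §6.4 Lemma 6.7] -/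
def geomConst (ε₀ s : ℝ) : ℝ := (1 + ε₀) ^ ((251 : ℝ) / 100) / (1 - (1 + ε₀) ^ (-s))

/-- `geomConst ε₀ s > 0` for `ε₀, s > 0`. [cite: Tao2016AveragedNS, §6.4 Lemma 6.7] -/
theorem geomConst_pos {ε₀ s : ℝ} (hε₀ : 0 < ε₀) (hs : 0 < s) : 0 < geomConst ε₀ s := by
  have h1 : (1 : ℝ) < 1 + ε₀ := by linarith
  have hρ : (1 + ε₀) ^ (-s) < 1 := Real.rpow_lt_one_of_one_lt_of_neg h1 (by linarith)
  exact div_pos (Real.rpow_pos_of_pos (by linarith) _) (by linarith)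

/-- **Summing over the past scales** (the mechanism of Lemma 6.7: "Applying (6.51) and summing
the geometric series"): if a function `F`, continuous on `[τ_{n₀-N}, 0]`, obeys
`F ≤ D (1+ε₀)^{(s + 251/100) k}` on each `[τ_{k-1}, τ_k]` (`n₀-N < k ≤ 0`), then
`∫_{τ_{n₀-N}}^{τ_k} F ≤ D C₃ geomConst ε₀ s (1+ε₀)^{s k}` for `n₀-N ≤ k ≤ 0`.
[cite: Tao2016AveragedNS, §6.4 Lemma 6.7] -/
theorem RescaledHypotheses.integral_past_le
    (h : RescaledHypotheses γ ε₀ K ε C₁ C₂ C₃ n₀ N τ Xr Er) (hε₀ : 0 < ε₀) (hC₃ : 0 ≤ C₃)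
    {F : ℝ → ℝ} (hF : ContinuousOn F (Icc (τ (n₀ - N)) 0)) {D s : ℝ} (hD : 0 ≤ D) (hs : 0 < s)
    (hbound : ∀ k, n₀ - N < k → k ≤ 0 → ∀ t ∈ Icc (τ (k - 1)) (τ k),
      F t ≤ D * (1 + ε₀) ^ ((s + (251 : ℝ) / 100) * k))
    {k : ℤ} (hk1 : n₀ - N ≤ k) (hk2 : k ≤ 0) :
    ∫ t in (τ (n₀ - N))..(τ k), F t ≤ D * C₃ * geomConst ε₀ s * (1 + ε₀) ^ (s * k) := by
  have h0 : (0 : ℝ) < 1 + ε₀ := by linarith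
  have h1 : (1 : ℝ) < 1 + ε₀ := by linarith
  have hρ : (1 + ε₀) ^ (-s) < 1 := Real.rpow_lt_one_of_one_lt_of_neg h1 (by linarith)
  have hρ0 : 0 < (1 + ε₀) ^ (-s) := Real.rpow_pos_of_pos h0 _
  have hG : 0 < geomConst ε₀ s := geomConst_pos hε₀ hs
  -- integrability on sub-intervals of `[τ₀, 0]`
  have hint : ∀ {x y : ℝ}, τ (n₀ - N) ≤ x → x ≤ y → y ≤ 0 → IntervalIntegrable F volume x y :=
    fun hx hxy hy => (hF.mono (Icc_subset_Icc hx hy)).intervalIntegrable_of_Icc hxy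
  induction k, hk1 using Int.leInduction with
  | base =>
    rw [integral_same]
    positivity
  | succ k hk ih =>
    have ih' := ih (by omega)
    have hτk : τ (n₀ - N) ≤ τ k := h.tau_init_le_tau hk (by omega)
    have hkk : τ k ≤ τ (k + 1) := by
      have := h.tau_lt (k + 1) (by omega) hk2
      simp only [add_sub_cancel_right] at this
      exact this.le
    have hk10 : τ (k + 1) ≤ 0 := h.tau_le (k + 1) (by omega) hk2
    rw [← integral_add_adjacent_intervals (hint le_rfl hτk (hkk.trans hk10))
      (hint hτk hkk hk10)]
    -- the new piece
    have hpiece : ∫ t in (τ k)..(τ (k + 1)), F t ≤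
        D * (1 + ε₀) ^ ((s + (251 : ℝ) / 100) * ((k + 1 : ℤ) : ℝ)) * (τ (k + 1) - τ k) := by
      have hb := hbound (k + 1) (by omega) hk2
      simp only [add_sub_cancel_right] at hb
      have := integral_mono_on hkk (hint hτk hkk hk10) (g := fun _ =>
        D * (1 + ε₀) ^ ((s + (251 : ℝ) / 100) * ((k + 1 : ℤ) : ℝ))) intervalIntegrable_const
        (fun t ht => hb t ht)
      rwa [intervalIntegral.integral_const, smul_eq_mul, mul_comm] at this
    -- length of the new piece: `τ_{k+1} - τ_k ≤ -τ_k ≤ C₃ q^{-(251/100) k}`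
    have hlen : τ (k + 1) - τ k ≤ C₃ * (1 + ε₀) ^ (-(251 : ℝ) / 100 * k) := by
      have := h.tau_ge' k hk (by omega)
      linarith
    have hstep : D * (1 + ε₀) ^ ((s + (251 : ℝ) / 100) * ((k + 1 : ℤ) : ℝ)) * (τ (k + 1) - τ k) ≤
        D * C₃ * (1 + ε₀) ^ ((251 : ℝ) / 100) * (1 + ε₀) ^ (s * ((k + 1 : ℤ) : ℝ)) := by
      calc D * (1 + ε₀) ^ ((s + (251 : ℝ) / 100) * ((k + 1 : ℤ) : ℝ)) * (τ (k + 1) - τ k)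
          ≤ D * (1 + ε₀) ^ ((s + (251 : ℝ) / 100) * ((k + 1 : ℤ) : ℝ)) *
              (C₃ * (1 + ε₀) ^ (-(251 : ℝ) / 100 * k)) :=
            mul_le_mul_of_nonneg_left hlen (by positivity)
        _ = D * C₃ * ((1 + ε₀) ^ ((s + (251 : ℝ) / 100) * ((k + 1 : ℤ) : ℝ)) *
              (1 + ε₀) ^ (-(251 : ℝ) / 100 * k)) := by ring
        _ = D * C₃ * (1 + ε₀) ^ ((251 : ℝ) / 100) * (1 + ε₀) ^ (s * ((k + 1 : ℤ) : ℝ)) := by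
            rw [← Real.rpow_add h0, mul_assoc (D * C₃), ← Real.rpow_add h0]
            congr 2; push_cast; ring
    -- combine with the induction hypothesis using `ρ + (1 - ρ) = 1`
    have hρk : (1 + ε₀) ^ (s * (k : ℝ)) = (1 + ε₀) ^ (-s) * (1 + ε₀) ^ (s * ((k + 1 : ℤ) : ℝ)) := by
      rw [← Real.rpow_add h0]; congr 1; push_cast; ring
    rw [hρk] at ih'
    have hP : 0 < (1 + ε₀) ^ (s * ((k + 1 : ℤ) : ℝ)) := Real.rpow_pos_of_pos h0 _
    have hkey : D * C₃ * geomConst ε₀ s * ((1 + ε₀) ^ (-s) * (1 + ε₀) ^ (s * ((k + 1 : ℤ) : ℝ))) +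
        D * C₃ * (1 + ε₀) ^ ((251 : ℝ) / 100) * (1 + ε₀) ^ (s * ((k + 1 : ℤ) : ℝ)) =
        D * C₃ * geomConst ε₀ s * (1 + ε₀) ^ (s * ((k + 1 : ℤ) : ℝ)) := by
      have hne : 1 - (1 + ε₀) ^ (-s) ≠ 0 := by linarith
      unfold geomConst
      field_simp
      ring
    linarith [hpiece, hstep, ih', hkey]

/-- The constant of **Lemma 6.7** for `m ∈ {-1, 0, 1}`:
`cumEnergyConst ε₀ C₃ = 2^{11} C₃ (1+ε₀)^{251/100} / (1 - (1+ε₀)^{-747/100})` (linear in the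
implied constant `C₃` of (6.51)). [cite: Tao2016AveragedNS, §6.4 Lemma 6.7] -/
def cumEnergyConst (ε₀ C₃ : ℝ) : ℝ := 2 ^ 11 * C₃ * geomConst ε₀ ((747 : ℝ) / 100)

/-- `cumEnergyConst ε₀ C₃ ≥ 0`. [cite: Tao2016AveragedNS, §6.4 Lemma 6.7] -/
theorem cumEnergyConst_nonneg {ε₀ C₃ : ℝ} (hε₀ : 0 < ε₀) (hC₃ : 0 ≤ C₃) :
    0 ≤ cumEnergyConst ε₀ C₃ := by
  unfold cumEnergyConst
  have := geomConst_pos hε₀ (s := (747 : ℝ) / 100) (by norm_num)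
  positivity

/-- **Lemma 6.7 (cumulative energy bound)**, explicit: for `m ∈ {-1, 0, 1}` and `K ≥ 1`,
`∫_{τ_{n₀-N}}^{τ_k} Ẽ_m ≤ cumEnergyConst ε₀ C₃ · (1+ε₀)^{(747/100) k}` for `n₀-N ≤ k ≤ 0`; in
particular (`k = 0`) `∫_{τ_{n₀-N}}^0 Ẽ_m ≤ cumEnergyConst ε₀ C₃`.
[cite: Tao2016AveragedNS, §6.4 Lemma 6.7] -/
theorem RescaledHypotheses.integral_energy_past_le
    (h : RescaledHypotheses γ ε₀ K ε C₁ C₂ C₃ n₀ N τ Xr Er) (hε₀ : 0 < ε₀) (hε₀1 : ε₀ < 1)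
    (hK : 1 ≤ K) (hC₃ : 0 ≤ C₃) {m : ℤ} (hm : m = -1 ∨ m = 0 ∨ m = 1) {k : ℤ} (hk1 : n₀ - N ≤ k)
    (hk2 : k ≤ 0) :
    ∫ t in (τ (n₀ - N))..(τ k), Er m t ≤ cumEnergyConst ε₀ C₃ * (1 + ε₀) ^ ((747 : ℝ) / 100 * k) := by
  have := h.integral_past_le hε₀ hC₃ (h.continuousOn_E m le_rfl) (D := 2 ^ 11)
    (s := (747 : ℝ) / 100) (by norm_num) (by norm_num) (fun k hk hk0 t ht => by
      have hb := h.energy_past_le hε₀ hε₀1 hK hm hk hk0 ht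
      convert hb using 3; norm_num) hk1 hk2
  unfold cumEnergyConst
  linarith

/-- Lemma 6.7 at the present time: `∫_{τ_{n₀-N}}^0 Ẽ_m ≤ cumEnergyConst ε₀ C₃` for
`m ∈ {-1, 0, 1}`. [cite: Tao2016AveragedNS, §6.4 Lemma 6.7] -/
theorem RescaledHypotheses.integral_energy_past_le_zero
    (h : RescaledHypotheses γ ε₀ K ε C₁ C₂ C₃ n₀ N τ Xr Er) (hε₀ : 0 < ε₀) (hε₀1 : ε₀ < 1)
    (hK : 1 ≤ K) (hC₃ : 0 ≤ C₃) (hN : n₀ ≤ N) {m : ℤ} (hm : m = -1 ∨ m = 0 ∨ m = 1) :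
    ∫ t in (τ (n₀ - N))..0, Er m t ≤ cumEnergyConst ε₀ C₃ := by
  have := h.integral_energy_past_le hε₀ hε₀1 hK hC₃ hm (k := 0) (by omega) le_rfl
  simpa [h.tau_zero] using this

/-- The refined cumulative bound for `Ẽ_1`: `∫_{τ_{n₀-N}}^{τ_k} Ẽ_1 ≤ K^{-30} C₃ geomConst ·
(1+ε₀)^{(747/100)k}` (used in Prop. 6.13). [cite: Tao2016AveragedNS, §6.6 Prop. 6.13] -/
theorem RescaledHypotheses.integral_energy_one_past_le
    (h : RescaledHypotheses γ ε₀ K ε C₁ C₂ C₃ n₀ N τ Xr Er) (hε₀ : 0 < ε₀) (hK : 0 < K)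
    (hC₃ : 0 ≤ C₃) {k : ℤ} (hk1 : n₀ - N ≤ k) (hk2 : k ≤ 0) :
    ∫ t in (τ (n₀ - N))..(τ k), Er 1 t ≤
      (K ^ 30)⁻¹ * C₃ * geomConst ε₀ ((747 : ℝ) / 100) * (1 + ε₀) ^ ((747 : ℝ) / 100 * k) :=
  h.integral_past_le hε₀ hC₃ (h.continuousOn_E 1 le_rfl) (by positivity) (by norm_num)
    (fun k hk hk0 t ht => by
      have hb := h.energy_one_past_le hε₀ hk hk0 ht
      convert hb using 3; norm_num) hk1 hk2

end Basic

end TaoCascade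

end Literature.Analysis.FluidPDE
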